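import Mathlib
import Literature.Computability.AlgebraicComplexity.FixedPointLog
import Summits.RiemannHypothesis.RiemannHypothesis.Theorems.WeilFormatCJointShiftSOS
import Summits.RiemannHypothesis.RiemannHypothesis.Theorems.WeilFormatCJointShiftCert
import Summits.RiemannHypothesis.RiemannHypothesis.Theorems.WeilFormatCJointShiftCertBrackets
import Summits.RiemannHypothesis.RiemannHypothesis.Theorems.WeilFormatCJointShiftCertSound
import Summits.RiemannHypothesis.RiemannHypothesis.Theorems.WeilFormatCCellShiftCert
import Summits.RiemannHypothesis.RiemannHypothesis.Theorems.WeilFormatCCellShiftCertCells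
import Summits.RiemannHypothesis.RiemannHypothesis.Theorems.WeilFormatCCellShiftCertCorr
import Summits.RiemannHypothesis.RiemannHypothesis.Theorems.WeilFormatCCellShiftCertTable
import Summits.RiemannHypothesis.RiemannHypothesis.Theorems.WeilFormatCCellShiftCertSound
import HarnessLib

/-!
# Cell-refined shift certificate (route K3): ROW-RANGE parts (kernel scaling) and their soundness

Helper file (`--supports stmt-RiemannHypothesis-0098`), RH-free; seat rh-explicit-weil-1 gen3.  The class parts of
`WeilFormatCCellShiftCert.lean` (`checkPart j`: classes with first frequency coordinate `≡ j mod nparts`) re-scan ALL Gram pairs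
in every part, so the kernel cost of one part does not go down with `nparts`; at Gram size `N = 192` a part no longer reduces
(measured: 48 monomials × 4 cells).  This file adds ROW-RANGE parts for the SAME certificate structure `CellSOS.Cert`: part `j`
runs the upper-triangular pair pass only over the rows `α ≡ j (mod nparts)` (all classes of those rows; the window entries go to
part `0`), so each part costs `≈ 1/nparts` of the pair scan, and returns its PARTIAL class table; the certificate CLAIMS these partial
tables (`T : List (List Entry)`, kernel fact `c.checkTab T j` = «`c.tableR j` equals `T[j]`» per part), and ONE cheap final pass merges the claimed tables class by
class (`mergeTables`) and bounds the merged (complete) classes (`checkMerge`).  `Cert.sound_real_M` is the soundness theorem with the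
SAME conclusion as `Cert.sound_real`.  Standard axioms only.
-/

set_option linter.dupNamespace false

noncomputable section

namespace Summit.RiemannHypothesis.RiemannHypothesis.Theorems.WeilFormatC

namespace CellSOS

open MeasureTheory Set Finset JointSOS
open scoped Real BigOperators

namespace Cert

variable (c : Cert)

/-! ### The row-range pair pass (computable) -/

/-- One step WITHOUT the class-part filter: skip only admissible classes. -/
def stepR (sα : ZVec4) (kα : ℕ) (cα : List ℤ) (sc : ZVec4 × ℕ × List ℤ) (acc : List Entry) : List Entry :=
  if c.adm (ckey (vsub sc.1 sα) sc.2.1 kα).1 (ckey (vsub sc.1 sα) sc.2.1 kα).2.1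
      (ckey (vsub sc.1 sα) sc.2.1 kα).2.2 then acc else
    ins (ckey (vsub sc.1 sα) sc.2.1 kα) (2 * dotZ cα sc.2.2) [] acc

/-- Inner pass over the later Gram entries (all classes). -/
def innerPassR (sα : ZVec4) (kα : ℕ) (cα : List ℤ) : List (ZVec4 × ℕ × List ℤ) → List Entry → List Entry
  | [], acc => acc
  | sc :: rest, acc =>
      match c.stepR sα kα cα sc acc with
      | [] => innerPassR sα kα cα rest []
      | en :: es => innerPassR sα kα cα rest (en :: es)

/-- Outer pass of range-part `j`: row `α` (position `i`) is processed iff `i % nparts = j`. -/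
def outerPassR (j : ℕ) : ℕ → List (ZVec4 × ℕ × List ℤ) → List Entry → List Entry
  | _, [], acc => acc
  | i, sa :: rest, acc =>
      if i % c.nparts = j then
        match c.innerPassR sa.1 sa.2.1 sa.2.2 rest acc with
        | [] => outerPassR j (i + 1) rest []
        | en :: es => outerPassR j (i + 1) rest (en :: es)
      else outerPassR j (i + 1) rest acc

/-- The table of range-part `j` (window entries of ALL classes in part `0`: `windowEntries 0` with the class-part filter of a
one-part certificate is not available, so we insert them with `windowEntriesR`). -/
def windowRowR (w : WItem) (k : ℕ) : List ℕ → List Entry → List Entry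
  | [], acc => acc
  | l :: rest, acc =>
      windowRowR w k rest (if !c.adm (uvec w.1 w.2.1) k l then ins (uvec w.1 w.2.1, k, l) 0 [w] acc else acc)

/-- Window entries for item `w` over first cells `k ∈ K`. -/
def windowCellsR (w : WItem) : List ℕ → List Entry → List Entry
  | [], acc => acc
  | k :: rest, acc => windowCellsR w rest (c.windowRowR w k (List.range c.pcells) acc)

/-- All window entries. -/
def windowEntriesR : List WItem → List Entry → List Entry
  | [], acc => acc
  | w :: rest, acc => windowEntriesR rest (c.windowCellsR w (List.range c.pcells) acc)

/-- The class table of range-part `j`. [folklore] -/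
def tableR (j : ℕ) : List Entry :=
  c.outerPassR j 0 c.mc (if j = 0 then c.windowEntriesR c.toJ.witems [] else [])

/-- Boolean equality of window-item lists (structural). -/
def witemsEqB : List WItem → List WItem → Bool
  | [], [] => true
  | w :: ws, w' :: ws' => decide (w = w') && witemsEqB ws ws'
  | _, _ => false

/-- Boolean equality of class tables (structural, component-wise `decide`). -/
def entriesEqB : List Entry → List Entry → Bool
  | [], [] => true
  | (κ, v, ws) :: r, (κ', v', ws') :: r' =>
      decide (κ.1 = κ'.1) && decide (κ.2.1 = κ'.2.1) && decide (κ.2.2 = κ'.2.2) && decide (v = v') &&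
        witemsEqB ws ws' && entriesEqB r r'
  | _, _ => false

/-- **Row-range part check** (one kernel file each): the kernel's partial table of part `j` IS the claimed `T[j]`. -/
def checkTab (T : List (List Entry)) (j : ℕ) : Bool := entriesEqB (c.tableR j) (T.getD j [])

/-- Insert every entry of a table into an accumulator (class-wise merge). -/
def insAll : List Entry → List Entry → List Entry
  | [], acc => acc
  | (κ, v, ws) :: rest, acc => insAll rest (ins κ v ws acc)

/-- Merge a list of (partial) class tables class by class. [folklore] -/
def mergeTables : List (List Entry) → List Entry
  | [] => []
  | t :: rest => insAll t (mergeTables rest)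

/-- **Final check on CLAIMED partial tables `T`** (one per row-range part): `T` has `nparts` tables and the merged table is
bounded by `Σ dparts` (so that `check`'s `g0 + Σ dparts ≤ D` closes the bound). [folklore] -/
def checkMerge (T : List (List Entry)) : Bool :=
  decide (T.length = c.nparts) && c.tableCheck (JointSOS.Cert.qsum c.dparts) (mergeTables T) 0

/-! ### Semantics -/

variable (f : ℝ → ℝ)

/-- The pair term without part filter. -/
def pairTermR (sa sc : ZVec4 × ℕ × List ℤ) : ℝ :=
  if c.adm (ckey (vsub sc.1 sa.1) sc.2.1 sa.2.1).1 (ckey (vsub sc.1 sa.1) sc.2.1 sa.2.1).2.1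
      (ckey (vsub sc.1 sa.1) sc.2.1 sa.2.1).2.2 then 0 else
    ((2 * dotZ sa.2.2 sc.2.2 : ℤ) : ℝ) / (4 : ℝ) ^ c.kbits * c.X f (ckey (vsub sc.1 sa.1) sc.2.1 sa.2.1)

/-- `val_stepR`. -/
theorem val_stepR (sa sc : ZVec4 × ℕ × List ℤ) (acc : List Entry) :
    c.val f (c.stepR sa.1 sa.2.1 sa.2.2 sc acc) = c.val f acc + c.pairTermR f sa sc := by
  unfold stepR pairTermR
  split_ifs with h1
  · rw [add_zero]
  · rw [val_ins]; simp only [JointSOS.Cert.wsum, mul_zero, add_zero]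

/-- `innerPassR_cons`. -/
theorem innerPassR_cons (sa sc : ZVec4 × ℕ × List ℤ) (rest : List (ZVec4 × ℕ × List ℤ)) (acc : List Entry) :
    c.innerPassR sa.1 sa.2.1 sa.2.2 (sc :: rest) acc = c.innerPassR sa.1 sa.2.1 sa.2.2 rest (c.stepR sa.1 sa.2.1 sa.2.2 sc acc) := by
  cases hs : c.stepR sa.1 sa.2.1 sa.2.2 sc acc <;> simp only [innerPassR, hs]

/-- `val_innerPassR`. -/
theorem val_innerPassR (sa : ZVec4 × ℕ × List ℤ) (L : List (ZVec4 × ℕ × List ℤ)) (acc : List Entry) :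
    c.val f (c.innerPassR sa.1 sa.2.1 sa.2.2 L acc) = c.val f acc + (L.map (c.pairTermR f sa)).sum := by
  induction L generalizing acc with
  | nil => simp [innerPassR]
  | cons sc rest ih => rw [innerPassR_cons, ih, val_stepR, List.map_cons, List.sum_cons]; ring

/-- The row-range triangular sum: rows at positions `i, i+1, …` with `position % nparts = j`. -/
def triSumR (j : ℕ) : ℕ → List (ZVec4 × ℕ × List ℤ) → ℝ
  | _, [] => 0
  | i, sa :: rest => (if i % c.nparts = j then (rest.map (c.pairTermR f sa)).sum else 0) + triSumR j (i + 1) rest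

/-- `outerPassR` unfolded on a cons. -/
theorem outerPassR_cons (j i : ℕ) (sa : ZVec4 × ℕ × List ℤ) (rest : List (ZVec4 × ℕ × List ℤ)) (acc : List Entry) :
    c.outerPassR j i (sa :: rest) acc =
      if i % c.nparts = j then c.outerPassR j (i + 1) rest (c.innerPassR sa.1 sa.2.1 sa.2.2 rest acc)
      else c.outerPassR j (i + 1) rest acc := by
  by_cases h : i % c.nparts = j
  · rw [if_pos h]
    cases hs : c.innerPassR sa.1 sa.2.1 sa.2.2 rest acc <;> simp only [outerPassR, h, ↓reduceIte, hs]
  · rw [if_neg h]; simp only [outerPassR, h, ↓reduceIte]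

/-- `val_outerPassR`. -/
theorem val_outerPassR (j : ℕ) (L : List (ZVec4 × ℕ × List ℤ)) (i : ℕ) (acc : List Entry) :
    c.val f (c.outerPassR j i L acc) = c.val f acc + c.triSumR f j i L := by
  induction L generalizing i acc with
  | nil => simp [outerPassR, triSumR]
  | cons sa rest ih =>
      rw [outerPassR_cons, triSumR]
      by_cases h : i % c.nparts = j
      · rw [if_pos h, if_pos h, ih, val_innerPassR]; ring
      · rw [if_neg h, if_neg h, ih]; ring

/-- The window term of `(w, k, l)` without part filter. -/
def winTermR (w : WItem) (kl : ℕ × ℕ) : ℝ :=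
  if !c.adm (uvec w.1 w.2.1) kl.1 kl.2 then 2 * c.toJ.wt w * c.X f (uvec w.1 w.2.1, kl.1, kl.2) else 0

/-- Value of `windowRowR`. -/
theorem val_windowRowR (w : WItem) (k : ℕ) (L : List ℕ) (acc : List Entry) :
    c.val f (c.windowRowR w k L acc) = c.val f acc + (L.map fun l ↦ c.winTermR f w (k, l)).sum := by
  induction L generalizing acc with
  | nil => simp [windowRowR]
  | cons l rest ih =>
      simp only [windowRowR, ih, List.map_cons, List.sum_cons, winTermR]
      split_ifs with h
      · rw [val_ins]; simp only [JointSOS.Cert.wsum]; push_cast; ring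
      · ring

/-- The window value of item `w` (no part filter). -/
def winValR (w : WItem) : ℝ :=
  ((List.range c.pcells).map fun k ↦ ((List.range c.pcells).map fun l ↦ c.winTermR f w (k, l)).sum).sum

/-- Value of `windowCellsR`. -/
theorem val_windowCellsR (w : WItem) (K : List ℕ) (acc : List Entry) :
    c.val f (c.windowCellsR w K acc) = c.val f acc +
      (K.map fun k ↦ ((List.range c.pcells).map fun l ↦ c.winTermR f w (k, l)).sum).sum := by
  induction K generalizing acc with
  | nil => simp [windowCellsR]
  | cons k rest ih => rw [windowCellsR, ih, val_windowRowR, List.map_cons, List.sum_cons]; ring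

/-- Value of `windowEntriesR`. -/
theorem val_windowEntriesR (W : List WItem) (acc : List Entry) :
    c.val f (c.windowEntriesR W acc) = c.val f acc + (W.map (c.winValR f)).sum := by
  induction W generalizing acc with
  | nil => simp [windowEntriesR]
  | cons w rest ih => rw [windowEntriesR, ih, val_windowCellsR, List.map_cons, List.sum_cons, winValR]; ring

/-- **Value of the table of range-part `j`.** -/
theorem val_tableR (j : ℕ) :
    c.val f (c.tableR j) = (if j = 0 then (c.toJ.witems.map (c.winValR f)).sum else 0) + c.triSumR f j 0 c.mc := by
  rw [tableR, val_outerPassR]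
  by_cases h : j = 0
  · rw [if_pos h, if_pos h, val_windowEntriesR]; simp [val]
  · rw [if_neg h, if_neg h]; simp [val]

/-- `insAll` adds the value of the inserted table. -/
theorem val_insAll (t acc : List Entry) : c.val f (insAll t acc) = c.val f acc + c.val f t := by
  induction t generalizing acc with
  | nil => simp [insAll, val]
  | cons en rest ih =>
      obtain ⟨κ, v, ws⟩ := en
      rw [insAll, ih, val_ins]
      simp only [val]; ring

/-- The merged table has the total value. -/
theorem val_mergeTables : ∀ (T : List (List Entry)), c.val f (mergeTables T) = (T.map (c.val f)).sum
  | [] => by simp [mergeTables, val]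
  | t :: rest => by rw [mergeTables, val_insAll, val_mergeTables rest, List.map_cons, List.sum_cons]; ring

/-- `Σ_{j < |T|} val T[j] = Σ (T.map val)`. -/
theorem sum_range_val_getD : ∀ (T : List (List Entry)),
    ∑ j ∈ Finset.range T.length, c.val f (T.getD j []) = (T.map (c.val f)).sum
  | [] => by simp
  | t :: rest => by
      rw [List.length_cons, Finset.sum_range_succ', List.map_cons, List.sum_cons]
      simp only [List.getD_cons_succ, List.getD_cons_zero]
      rw [sum_range_val_getD rest, add_comm]

variable {c f}

/-- `witemsEqB` is sound. -/
theorem witemsEqB_spec : ∀ {l l' : List WItem}, witemsEqB l l' = true → l = l'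
  | [], [], _ => rfl
  | w :: ws, w' :: ws', h => by
      simp only [witemsEqB, Bool.and_eq_true, decide_eq_true_eq] at h
      rw [h.1, witemsEqB_spec h.2]
  | [], _ :: _, h => by simp [witemsEqB] at h
  | _ :: _, [], h => by simp [witemsEqB] at h

/-- `entriesEqB` is sound. -/
theorem entriesEqB_spec : ∀ {l l' : List Entry}, entriesEqB l l' = true → l = l'
  | [], [], _ => rfl
  | (κ, v, ws) :: r, (κ', v', ws') :: r', h => by
      simp only [entriesEqB, Bool.and_eq_true, decide_eq_true_eq] at h
      obtain ⟨⟨⟨⟨⟨h1, h2⟩, h3⟩, h4⟩, h5⟩, h6⟩ := h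
      have hκ : κ = κ' := Prod.ext h1 (Prod.ext h2 h3)
      rw [hκ, h4, witemsEqB_spec h5, entriesEqB_spec h6]
  | [], _ :: _, h => by simp [entriesEqB] at h
  | (_, _, _) :: _, [], h => by simp [entriesEqB] at h

/-- The pair term without filter equals twice the full term on Gram rows with cells `< p` (admissible ⇒ both vanish). -/
theorem pairTermR_eq (hXadm : ∀ (γ : ZVec4) (k l : ℕ), k < c.pcells → l < c.pcells → c.adm γ k l = true → c.X f (γ, k, l) = 0)
    (sa sc : ZVec4 × ℕ × List ℤ) (hka : sa.2.1 < c.pcells) (hkc : sc.2.1 < c.pcells) :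
    c.pairTermR f sa sc = 2 * c.fullTerm f sa sc := by
  have hX : c.X f (ckey (vsub sc.1 sa.1) sc.2.1 sa.2.1) = c.X f (vsub sc.1 sa.1, sc.2.1, sa.2.1) := X_ckey f _ _ _
  have hcells : ((ckey (vsub sc.1 sa.1) sc.2.1 sa.2.1).2.1 < c.pcells ∧
      (ckey (vsub sc.1 sa.1) sc.2.1 sa.2.1).2.2 < c.pcells) := by
    unfold ckey; split_ifs
    · exact ⟨lt_of_le_of_lt (min_le_left _ _) hkc, max_lt hkc hka⟩
    · exact ⟨hkc, hka⟩
    · exact ⟨hka, hkc⟩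
  unfold pairTermR fullTerm
  by_cases h : c.adm (ckey (vsub sc.1 sa.1) sc.2.1 sa.2.1).1 (ckey (vsub sc.1 sa.1) sc.2.1 sa.2.1).2.1
      (ckey (vsub sc.1 sa.1) sc.2.1 sa.2.1).2.2 = true
  · simp only [h, ↓reduceIte]
    have h0 := hXadm _ _ _ hcells.1 hcells.2 h
    rw [← hX, h0]; ring
  · simp only [h, Bool.false_eq_true, ↓reduceIte]
    rw [hX]; push_cast; ring

/-- Summing the row-range sums over the parts gives `upper2` (every row is in exactly one range). -/
theorem sum_triSumR (hn : 0 < c.nparts)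
    (hXadm : ∀ (γ : ZVec4) (k l : ℕ), k < c.pcells → l < c.pcells → c.adm γ k l = true → c.X f (γ, k, l) = 0) :
    ∀ (L : List (ZVec4 × ℕ × List ℤ)) (i : ℕ), (∀ sa ∈ L, sa.2.1 < c.pcells) →
      ∑ j ∈ Finset.range c.nparts, c.triSumR f j i L = upper2 c f L
  | [], i, _ => by simp [triSumR, upper2]
  | sa :: rest, i, hL => by
      have hsa : sa.2.1 < c.pcells := hL sa (by simp)
      have hrest : ∀ sc ∈ rest, sc.2.1 < c.pcells := fun sc h ↦ hL sc (List.mem_cons_of_mem _ h)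
      simp only [triSumR, upper2, Finset.sum_add_distrib]
      rw [sum_triSumR hn hXadm rest (i + 1) hrest, Finset.sum_ite_eq]
      have hi : i % c.nparts ∈ Finset.range c.nparts := Finset.mem_range.2 (Nat.mod_lt _ hn)
      rw [if_pos hi]
      congr 1
      refine congrArg List.sum (List.map_congr_left fun sc hsc ↦ ?_)
      exact pairTermR_eq hXadm sa sc hsa (hrest sc hsc)

/-- Summed over the (unfiltered) cell pairs, the window value of `w` is `2·wt(w)·I_f(e log p_j)`. -/
theorem winValR_eq (hp : 0 < c.pcells) (hf : Measurable f) {C : ℝ} (hC : ∀ x, |f x| ≤ C)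
    (hsupp : ∀ x, x ∉ Icc (-(c.aQ : ℝ)) c.aQ → f x = 0)
    (hXadm : ∀ (γ : ZVec4) (k l : ℕ), k < c.pcells → l < c.pcells → c.adm γ k l = true → c.X f (γ, k, l) = 0)
    (w : WItem) :
    c.winValR f w = 2 * c.toJ.wt w * ∫ x, f (x - c.toJ.phi (uvec w.1 w.2.1)) * f x := by
  simp only [winValR, list_range_sum]
  rw [← sum_sum_X hp hf hC hsupp (uvec w.1 w.2.1), Finset.mul_sum]
  refine Finset.sum_congr rfl fun k hk ↦ ?_
  rw [Finset.mul_sum]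
  refine Finset.sum_congr rfl fun l hl ↦ ?_
  by_cases hadm : c.adm (uvec w.1 w.2.1) k l = true
  · have h0 := hXadm _ _ _ (Finset.mem_range.1 hk) (Finset.mem_range.1 hl) hadm
    simp only [winTermR, hadm, Bool.not_true, Bool.false_eq_true, ↓reduceIte, h0, mul_zero]
  · simp only [winTermR, hadm, Bool.not_false, ↓reduceIte]

/-! ### The main theorem for row-range parts -/

/-- **Soundness with row-range parts and merged tables (at the certificate's window `aQ`).** -/
theorem sound_real_M_aQ (c : Cert) (T : List (List Entry)) (hc : c.check = true)
    (hparts : ∀ j < c.nparts, c.checkTab T j = true) (hmerge : c.checkMerge T = true)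
    {f : ℝ → ℝ} (hf : Measurable f) {C : ℝ} (hC : ∀ x, |f x| ≤ C)
    (hsupp : ∀ x, x ∉ Icc (-(c.aQ : ℝ)) c.aQ → f x = 0) :
    (c.toJ.witems.map fun w ↦ 2 * (Real.log (c.toJ.pj w.1) / Real.sqrt ((c.toJ.pj w.1 : ℝ) ^ w.2.1)) *
        ∫ x, f (x - (w.2.1 : ℝ) * Real.log (c.toJ.pj w.1)) * f x).sum
      ≤ (c.D : ℝ) * ∫ x, f x ^ 2 := by
  simp only [check, Bool.and_eq_true, decide_eq_true_eq] at hc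
  obtain ⟨⟨⟨⟨⟨⟨⟨⟨⟨⟨⟨hh, hl⟩, _⟩, hwin⟩, hcols⟩, hden⟩, hn⟩, hp⟩, hlenp⟩, hg0⟩, hmass⟩, hD⟩ := hc
  have hwin' := JointSOS.Cert.windowOK_spec hwin
  have hcells := fun sc h ↦ (colsOK_spec hcols sc h).2
  have hE : 0 ≤ ∫ x, f x ^ 2 := integral_nonneg fun x ↦ sq_nonneg _
  have hXle : ∀ κ : CKey, |c.X f κ| ≤ ∫ x, f x ^ 2 := abs_X_le hf hC hsupp
  have hXadm : ∀ (γ : ZVec4) (k l : ℕ), k < c.pcells → l < c.pcells → c.adm γ k l = true → c.X f (γ, k, l) = 0 :=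
    fun γ k l hk hl' h ↦ X_eq_zero_of_adm f hh hl hden hp hk hl' h
  -- the merged claimed table: value = Σ_j val (tableR j), bound ≤ Σ dparts
  simp only [checkMerge, Bool.and_eq_true, decide_eq_true_eq] at hmerge
  obtain ⟨hTlen, hmc⟩ := hmerge
  obtain ⟨hatt, hbd⟩ := tableCheck_spec hmc
  rw [zero_add] at hbd
  have hmergeVal : c.val f (mergeTables T) = ∑ j ∈ Finset.range c.nparts, c.val f (c.tableR j) := by
    rw [val_mergeTables, ← sum_range_val_getD, hTlen]
    exact Finset.sum_congr rfl fun j hj ↦ by rw [entriesEqB_spec (hparts j (Finset.mem_range.1 hj))]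
  have hle : ∑ j ∈ Finset.range c.nparts, c.val f (c.tableR j) ≤
      ((JointSOS.Cert.qsum c.dparts : ℚ) : ℝ) * ∫ x, f x ^ 2 := by
    rw [← hmergeVal]
    have hbd' : (c.tableBound (mergeTables T) : ℝ) ≤ ((JointSOS.Cert.qsum c.dparts : ℚ) : ℝ) := by exact_mod_cast hbd
    exact (val_le_tableBound hh hl hXle _ hatt).trans (mul_le_mul_of_nonneg_right hbd' hE)
  set W : ℝ := (c.toJ.witems.map fun w ↦ 2 * c.toJ.wt w * ∫ x, f (x - c.toJ.phi (uvec w.1 w.2.1)) * f x).sum with hW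
  have hwin_sum : (c.toJ.witems.map (c.winValR f)).sum = W := by
    rw [hW]; exact congrArg List.sum (List.map_congr_left fun w _ ↦ winValR_eq hp hf hC hsupp hXadm w)
  have hsum : ∑ j ∈ Finset.range c.nparts, c.val f (c.tableR j) = W + upper2 c f c.mc := by
    simp only [val_tableR, Finset.sum_add_distrib]
    rw [sum_triSumR hn hXadm c.mc 0 hcells, Finset.sum_ite_eq', if_pos (Finset.mem_range.2 hn), hwin_sum]
  have hpos : 0 ≤ diag c f c.mc + upper2 c f c.mc := by
    rw [diag_add_upper2]; exact pairSum_nonneg hcols hf hC hsupp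
  have hdiag : diag c f c.mc ≤ (c.g0 : ℝ) * ∫ x, f x ^ 2 := by
    rw [diag_eq_sum_massOf c.mc hcells, ← sum_X_zero hp hf hC hsupp, Finset.mul_sum]
    refine Finset.sum_le_sum fun k hk ↦ ?_
    have hm : (massOf k c.mc : ℝ) ≤ (c.g0 : ℝ) * (4 : ℝ) ^ c.kbits := by
      have := massOK_spec hmass k (List.mem_range.2 (Finset.mem_range.1 hk))
      exact_mod_cast this
    have h4 : (0 : ℝ) < (4 : ℝ) ^ c.kbits := by positivity
    refine mul_le_mul_of_nonneg_right ?_ (X_zero_nonneg k)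
    rw [div_le_iff₀ h4]; exact hm
  have hsumD : ((JointSOS.Cert.qsum c.dparts : ℚ) : ℝ) + (c.g0 : ℝ) ≤ (c.D : ℝ) := by
    have : ((c.g0 + JointSOS.Cert.qsum c.dparts : ℚ) : ℝ) ≤ (c.D : ℝ) := by exact_mod_cast hD
    push_cast at this; linarith
  have hT : W = (c.toJ.witems.map fun w ↦ 2 * (Real.log (c.toJ.pj w.1) / Real.sqrt ((c.toJ.pj w.1 : ℝ) ^ w.2.1)) *
        ∫ x, f (x - (w.2.1 : ℝ) * Real.log (c.toJ.pj w.1)) * f x).sum := by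
    rw [hW]
    refine congrArg List.sum (List.map_congr_left fun w hw ↦ ?_)
    have hj := (JointSOS.Cert.witemOK_spec (hwin' w hw)).1
    rw [JointSOS.Cert.phi_uvec c.toJ hj]
    simp only [JointSOS.Cert.wt]; push_cast; ring
  rw [← hT]
  have : W = ∑ j ∈ Finset.range c.nparts, c.val f (c.tableR j) - upper2 c f c.mc := by linarith
  rw [this]
  nlinarith [hle, hpos, hdiag, hsumD, hE, mul_le_mul_of_nonneg_right hsumD hE]

/-- **Soundness with row-range parts and merged tables**: if `c.check = true`, the claimed partial tables are the kernel's
(`c.tableR j = T[j]`, `j < nparts`) and `c.checkMerge T = true`, then for every `a ≤ c.aQ` and every real measurable bounded `f`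
vanishing off `[−a, a]`, the joint shift bound with constant `c.D` holds (same statement as `Cert.sound_real`). -/
theorem sound_real_M (c : Cert) (T : List (List Entry)) (hc : c.check = true)
    (hparts : ∀ j < c.nparts, c.checkTab T j = true) (hmerge : c.checkMerge T = true)
    {a : ℝ} (ha : a ≤ c.aQ) {f : ℝ → ℝ} (hf : Measurable f) {C : ℝ} (hC : ∀ x, |f x| ≤ C)
    (hsupp : ∀ x, x ∉ Icc (-a) a → f x = 0) :
    (c.toJ.witems.map fun w ↦ 2 * (Real.log (c.toJ.pj w.1) / Real.sqrt ((c.toJ.pj w.1 : ℝ) ^ w.2.1)) *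
        ∫ x, f (x - (w.2.1 : ℝ) * Real.log (c.toJ.pj w.1)) * f x).sum
      ≤ (c.D : ℝ) * ∫ x, f x ^ 2 := by
  refine sound_real_M_aQ c T hc hparts hmerge hf hC fun x hx ↦ hsupp x fun h ↦ hx ?_
  exact ⟨by linarith [h.1], by linarith [h.2]⟩

end Cert

end CellSOS

end Summit.RiemannHypothesis.RiemannHypothesis.Theorems.WeilFormatC
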